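import Mathlib
import HarnessLib
import Literature.Combinatorics.SimpleGraph.WallTopologicalMinor
import Literature.Combinatorics.SimpleGraph.SubcubicMinors
import Summits.ValiantsHypothesis.ValiantsHypothesis.Theorems.MonotoneRestorationMonotoneRestorationQPLinearWidthTopologicalMinorIsMinor

/-!
# Route MonotoneRestoration, crux `MonotoneRestorationQP` (stmt-15886), line `linear_width` —
# MINORS COMPOSE; SUBCUBIC MINORS OF THE GRID ARE TOPOLOGICAL MINORS OF EVERY GRAPH WITH A GRID MINOR

Helper file (`--supports stmt-ValiantsHypothesis-15886`), def-free.  Generic piece of the supply chain behind the hypothesis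
(ODD₂) of `CFIOddCover.widthRung_sqrt_of_oddCovers` (this session): the Excluded Grid Theorem delivers a GRID MINOR
`grid R R ≼ₘ F` of the pattern graph; what the odd-cover witnesses consume is a SUBDIVIDED WALL with long paths, i.e. a
subcubic graph `H` (a `k`-subdivision of a wall, itself a subgraph of a larger grid) as a TOPOLOGICAL minor of `F`.  The two
tree facts `IsMinor.isTopologicalMinor_of_degree_le_three` (Diestel 1.7.2 (ii)) and `wall_isTopologicalMinor_of_grid_isMinor`
need, in between, the TRANSITIVITY of the minor relation, which the tree (`SubcubicMinors.lean`: `refl`, `of_le_left`,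
`mono_right`) does not record.  Here:

* `IsMinor.trans` — **`H ≼ₘ G → G ≼ₘ K → H ≼ₘ K`** (compose the branch-set maps: the branch set of `u` in `K` is the union of
  the `K`-branch sets of the vertices of the `G`-branch set of `u`; it is connected because a walk inside the `G`-branch set
  lifts, edge by edge, to a walk through the corresponding `K`-branch sets);
* `isMinor_of_injective_hom` — an injective homomorphism `H →g G` (subgraph containment on another vertex type) makes `H` a
  minor of `G` (via the tree's `IsTopologicalMinor.of_hom` and `IsTopologicalMinor.isMinor`, p841558);
* `IsTopologicalMinor.trans_isMinor`, `isTopologicalMinor_of_subcubic_of_grid` — **every subcubic `H` with `H ≼ₘ grid R R`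
  (e.g. a subgraph of the grid) is a topological minor of every `F` with `grid R R ≼ₘ F`**; and tree-width transfers
  (`treewidth_le_of_isMinor_trans`).

Honest label: library-type facts (Diestel §1.7); no stub closed; θ₁, the cruxes and VP ≠ VNP NOT moved.
[cite: Diestel2010, §1.7 (Prop. 1.7.1, Prop. 1.7.2 (ii)); GalesiEtAl2023, §2 and Cor. 9]
-/

set_option linter.dupNamespace false

noncomputable section

open scoped Classical
open scoped Literature.Combinatorics.SimpleGraph

namespace Summit.ValiantsHypothesis.ValiantsHypothesis.Theorems.CFIOddCover

open Literature.Combinatorics.SimpleGraph (treewidth IsMinor IsTopologicalMinor wall grid)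
open Summit.ValiantsHypothesis.ValiantsHypothesis.Theorems.CFIHomMonotone (IsTopologicalMinor.isMinor
  treewidth_le_of_isMinor)

/-! ### Transitivity of the minor relation -/

/-- **Minors compose: `H ≼ₘ G → G ≼ₘ K → H ≼ₘ K`.**  The composite branch-set map is `z ↦ (φ₂ z).bind φ₁`; branch sets are
nonempty and realise the edges of `H` by composition, and they are connected: a walk inside the `G`-branch set of `u` lifts
edge by edge (an edge of `G` is realised by an edge of `K` between the two `K`-branch sets, which are themselves connected)
to a walk of `K` inside the composite branch set. [cite: Diestel2010, §1.7 (Prop. 1.7.1: the minor relation is transitive)] -/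
theorem IsMinor.trans {α β γ : Type*} {H : SimpleGraph α} {G : SimpleGraph β} {K : SimpleGraph γ}
    (h₁ : H ≼ₘ G) (h₂ : G ≼ₘ K) : H ≼ₘ K := by
  classical
  obtain ⟨φ₁, hne₁, hconn₁, hedge₁⟩ := h₁
  obtain ⟨φ₂, hne₂, hconn₂, hedge₂⟩ := h₂
  refine ⟨fun z => (φ₂ z).bind φ₁, fun u => ?_, ?_, fun u w huw => ?_⟩
  · obtain ⟨x, hx⟩ := hne₁ u
    obtain ⟨z, hz⟩ := hne₂ x
    exact ⟨z, by simp [hz, hx]⟩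
  · -- connectivity of the composite branch sets
    -- lifting a walk inside a `G`-branch set to a walk of `K` inside the composite branch set
    have key : ∀ (u : α) {x x' : β} (p : G.Walk x x'), (∀ b ∈ p.support, φ₁ b = some u) →
        ∀ z z' : γ, φ₂ z = some x → φ₂ z' = some x' →
          ∃ q : K.Walk z z', ∀ t ∈ q.support, (φ₂ t).bind φ₁ = some u := by
      intro u x x' p
      induction p with
      | @nil x =>
        intro hsupp z z' hz hz'
        have hx : φ₁ x = some u := hsupp x (by simp)
        obtain ⟨q, hq⟩ := hconn₂ z z' (by rw [hz, hz']) (by simp [hz])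
        exact ⟨q, fun t ht => by rw [hq t ht, hz, Option.bind_some, hx]⟩
      | @cons x b x' hxb p' ih =>
        intro hsupp z z' hz hz'
        have hx : φ₁ x = some u := hsupp x (by simp)
        have hsupp' : ∀ b' ∈ p'.support, φ₁ b' = some u :=
          fun b' hb' => hsupp b' (by simp [hb'])
        obtain ⟨z₁, w₁, hz₁, hw₁, hzw⟩ := hedge₂ x b hxb
        obtain ⟨q₁, hq₁⟩ := hconn₂ z z₁ (by rw [hz, hz₁]) (by simp [hz])
        obtain ⟨q₂, hq₂⟩ := ih hsupp' w₁ z' hw₁ hz'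
        refine ⟨q₁.append (SimpleGraph.Walk.cons hzw q₂), fun t ht => ?_⟩
        rw [SimpleGraph.Walk.mem_support_append_iff, SimpleGraph.Walk.support_cons, List.mem_cons] at ht
        rcases ht with ht | rfl | ht
        · rw [hq₁ t ht, hz, Option.bind_some, hx]
        · rw [hz₁, Option.bind_some, hx]
        · exact hq₂ t ht
    intro z z' hzz' hne
    change (φ₂ z).bind φ₁ = (φ₂ z').bind φ₁ at hzz'
    change (φ₂ z).bind φ₁ ≠ none at hne
    -- `z` lies in the `K`-branch set of some `x` in the `G`-branch set of some `u`
    obtain ⟨x, hz⟩ : ∃ x, φ₂ z = some x := by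
      cases h : φ₂ z with
      | none => simp [h] at hne
      | some x => exact ⟨x, rfl⟩
    obtain ⟨u, hx⟩ : ∃ u, φ₁ x = some u := by
      cases h : φ₁ x with
      | none => simp [hz, h] at hne
      | some u => exact ⟨u, rfl⟩
    have hφz : (φ₂ z).bind φ₁ = some u := by rw [hz, Option.bind_some, hx]
    obtain ⟨x', hz'⟩ : ∃ x', φ₂ z' = some x' := by
      cases h : φ₂ z' with
      | none =>
        have : (φ₂ z').bind φ₁ = none := by rw [h, Option.bind_none]
        exact absurd (hzz'.trans this) hne
      | some x' => exact ⟨x', rfl⟩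
    have hx' : φ₁ x' = some u := by
      have h1 : (φ₂ z').bind φ₁ = some u := by rw [← hzz']; exact hφz
      rwa [hz', Option.bind_some] at h1
    obtain ⟨p, hp⟩ := hconn₁ x x' (by rw [hx, hx']) (by simp [hx])
    obtain ⟨q, hq⟩ := key u p (fun b hb => by rw [hp b hb, hx]) z z' hz hz'
    refine ⟨q, fun t ht => ?_⟩
    show (φ₂ t).bind φ₁ = (φ₂ z).bind φ₁
    rw [hq t ht, hφz]
  · obtain ⟨x, y, hx, hy, hxy⟩ := hedge₁ u w huw
    obtain ⟨z, t, hz, ht, hzt⟩ := hedge₂ x y hxy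
    exact ⟨z, t, by simp [hz, hx], by simp [ht, hy], hzt⟩

/-- **An injective homomorphism makes a minor**: if `H` maps injectively and edge-preservingly into `G` (subgraph containment
across vertex types), then `H ≼ₘ G`. [cite: Diestel2010, §1.7] -/
theorem isMinor_of_injective_hom {α β : Type*} {H : SimpleGraph α} {G : SimpleGraph β} (φ : H →g G)
    (hφ : Function.Injective φ) : H ≼ₘ G :=
  IsTopologicalMinor.isMinor (IsTopologicalMinor.of_hom φ hφ (IsTopologicalMinor.refl G))

/-- **Topological minor of a minor**: `H ≼ₜ G → G ≼ₘ K → H ≼ₘ K`. [cite: Diestel2010, §1.7] -/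
theorem IsTopologicalMinor.trans_isMinor {α β γ : Type*} {H : SimpleGraph α} {G : SimpleGraph β}
    {K : SimpleGraph γ} (h₁ : H ≼ₜ G) (h₂ : G ≼ₘ K) : H ≼ₘ K :=
  IsMinor.trans (IsTopologicalMinor.isMinor h₁) h₂

/-- **Subcubic minors of a minor are topological minors**: if every vertex of `H` has at most three neighbours,
`H ≼ₘ G` and `G ≼ₘ K`, then `H ≼ₜ K` (Diestel 1.7.2 (ii) after composing). [cite: Diestel2010, Prop. 1.7.2 (ii)] -/
theorem isTopologicalMinor_of_neighbors_le_three_trans {α β γ : Type*} {H : SimpleGraph α} {G : SimpleGraph β}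
    {K : SimpleGraph γ} (h3 : ∀ u : α, ∃ l : List α, l.length ≤ 3 ∧ ∀ v, H.Adj u v → v ∈ l)
    (h₁ : H ≼ₘ G) (h₂ : G ≼ₘ K) : H ≼ₜ K :=
  (IsMinor.trans h₁ h₂).isTopologicalMinor_of_neighbors_le_three h3

/-- **THE SUPPLY STEP.**  Every subcubic graph `H` contained in the grid `𝓗_{R,R}` as a subgraph (injective homomorphism —
e.g. a subdivided wall drawn along the grid lines) is a TOPOLOGICAL minor of every graph `F` with `grid R R ≼ₘ F`: `F`
contains a subdivision of `H`.  With the Excluded Grid Theorem (`tw F` large ⇒ `grid R R ≼ₘ F`) this is how long subdivided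
walls get into wide patterns. [cite: Diestel2010, Prop. 1.7.2 (ii); GalesiEtAl2023, Cor. 9] -/
theorem isTopologicalMinor_of_subcubic_of_grid {α γ : Type*} {H : SimpleGraph α} {F : SimpleGraph γ} {R : ℕ}
    (h3 : ∀ u : α, ∃ l : List α, l.length ≤ 3 ∧ ∀ v, H.Adj u v → v ∈ l)
    (σ : H →g grid R R) (hσ : Function.Injective σ) (hF : grid R R ≼ₘ F) : H ≼ₜ F :=
  isTopologicalMinor_of_neighbors_le_three_trans h3 (isMinor_of_injective_hom σ hσ) hF

/-- **Tree-width along a chain of minors**: `H ≼ₘ G ≼ₘ K ⇒ tw H ≤ tw K` (finite `K`). [cite: Diestel2010, Prop. 12.3.6] -/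
theorem treewidth_le_of_isMinor_trans {α β γ : Type*} [Fintype α] [Fintype γ] {H : SimpleGraph α} {G : SimpleGraph β}
    {K : SimpleGraph γ} (h₁ : H ≼ₘ G) (h₂ : G ≼ₘ K) : treewidth H ≤ treewidth K :=
  treewidth_le_of_isMinor (IsMinor.trans h₁ h₂)

end Summit.ValiantsHypothesis.ValiantsHypothesis.Theorems.CFIOddCover

end
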